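import Literature.AlgebraicGeometry.Resolution.LinearSectionsChoice
import Literature.AlgebraicGeometry.Resolution.NormalSurfaceSingularLocus
import Literature.AlgebraicGeometry.Resolution.BlowupRegularPoints
import Literature.AlgebraicGeometry.Dimension.FibreLocalRingDimension
import HarnessLib

/-!
# The singular locus of `X ↪ ℙ^N_k`: closed, and of codimension `≥ 2` when `X` is normal

Topic: `Literature/AlgebraicGeometry/Resolution`. Dimension bookkeeping for the Bertini paragraph
of de Jong's proof of Lemma 4.11 (de Jong 1996, p. 68: "By Bertini's theorem we may choose `π`
such that the general fibre of `f` is smooth" — possible because `X` is normal, so that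
`Sing X` has codimension `≥ 2` and a general curve section misses it):

* `LinSec.singSet_eq_compl_regularLocus` / `LinSec.isClosed_singSet` — `Sing X = (Reg X)ᶜ` is
  closed for `X` locally of finite type over a perfect field (the tree's
  `isOpen_regularLocus_of_locallyOfFiniteType_perfectField`, Matsumura §30);
* `LinSec.genericPoint_notMem_singSet` — the generic point is a regular point;
* `LinSec.topologicalKrullDim_singSet_lt` — **`dim Sing X < d`** for `X` normal integral of
  finite type over `k` of dimension `d + 1`: singular points of a normal scheme have
  `dim 𝒪_{X,x} ≥ 2` (the tree's `two_le_ringKrullDim_stalk_of_not_mem_regularLocus`, "normal ⇒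
  (R₁)", Matsumura Thm. 11.2) and `dim 𝒪_{X,x} + dim cl{x} = dim X`
  (`coheight_add_height_eq_topologicalKrullDim`);
* `LinSec.isClosed_singleton_of_topologicalKrullDim_lt_one` — the points of a closed subset of
  dimension `≤ 0` are closed points.

Everything is proved; no named facts.

## References

* A. J. de Jong, *Smoothness, semi-stability and alterations*, Publ. Math. IHÉS 83 (1996),
  proof of Lemma 4.11, p. 68. [DeJong1996]
* H. Matsumura, *Commutative Ring Theory* (1986), Thm. 11.2, Thm. 23.8, §30. [Matsumura1987]
-/

noncomputable section

open CategoryTheory AlgebraicGeometry TopologicalSpace Topology Order IsLocalRing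
open Literature.AlgebraicGeometry.Morphisms.ProjCech (grading PP)
open Literature.AlgebraicGeometry.Motives
open Literature.Topology

attribute [local instance] MvPolynomial.gradedAlgebra

namespace Literature.AlgebraicGeometry.Resolution

universe u

namespace LinSec

variable {k : Type u} [Field k] {X : Scheme.{u}}

/-! ## `Sing X` is closed -/

/-- `Sing X` (`LinSec.singSet`) is the complement of the tree's regular locus `Scheme.regularLocus`.
[folklore] -/
theorem singSet_eq_compl_regularLocus : singSet X = (Scheme.regularLocus X)ᶜ := rfl

/-- **`Sing X` is closed** for `X` locally of finite type over a perfect field (the regular locus is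
open, `isOpen_regularLocus_of_locallyOfFiniteType_perfectField`).
[cite: Matsumura1987, §30 Cor. to Thm. 30.5] -/
theorem isClosed_singSet [PerfectField k] (fX : X ⟶ Spec (.of k)) [LocallyOfFiniteType fX] :
    IsClosed (singSet X) := by
  rw [singSet_eq_compl_regularLocus, isClosed_compl_iff]
  exact isOpen_regularLocus_of_locallyOfFiniteType_perfectField fX

/-- The generic point of the integral `X` is a regular point (its local ring is a field).
[folklore] -/
theorem genericPoint_notMem_singSet [IsIntegral X] : genericPoint X ∉ singSet X := by
  intro h
  apply h
  have hF : IsField (X.presheaf.stalk (genericPoint X)) :=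
    isField_stalk_of_closure_mem_irreducibleComponents X (genericPoint X) (by
      rw [genericPoint_closure, irreducibleComponents_eq_singleton]; exact Set.mem_singleton _)
  letI := hF.toField
  infer_instance

/-! ## Normal ⇒ `codim Sing X ≥ 2` -/

/-- **`dim Sing X < d` for a normal integral `X` of finite type over `k` with `dim X = d + 1`**:
a chain of specialisations inside `Sing X` ending at `x` has length `≤ dim cl{x} = dim X -
dim 𝒪_{X,x} ≤ d + 1 - 2`. [cite: Matsumura1987, Thm. 11.2] -/
theorem topologicalKrullDim_singSet_lt [IsIntegral X] (fX : X ⟶ Spec (.of k)) [LocallyOfFiniteType fX]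
    (hN : ∀ x : X, IsIntegrallyClosed (X.presheaf.stalk x)) {d : ℕ}
    (hdim : topologicalKrullDim X = (d + 1 : ℕ)) (hcl : IsClosed (singSet X)) :
    topologicalKrullDim ↥(singSet X) < (d : WithBot ℕ∞) := by
  haveI : IsLocallyNoetherian X := LocallyOfFiniteType.isLocallyNoetherian fX
  haveI := quasiSober_of_isClosed hcl
  letI : Preorder ↥(singSet X) := (specializationOrder _).toPreorder
  rw [topologicalKrullDim_eq_krullDim, Order.krullDim_lt_coe_iff]
  intro l
  -- the inclusion is strictly monotone for the specialisation orders
  have hval : StrictMono (Subtype.val : ↥(singSet X) → X) := by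
    intro a b hab
    have hba : (b : X) ⤳ (a : X) := (subtype_specializes_iff b a).1 (show b ⤳ a from hab.le)
    have hle : (a : X) ≤ (b : X) := Scheme.le_iff_specializes.mpr hba
    refine lt_of_le_not_ge hle fun hge => hab.not_ge ?_
    have hab' : (a : X) ⤳ (b : X) := Scheme.le_iff_specializes.mp hge
    change a ⤳ b
    exact (subtype_specializes_iff a b).2 hab'
  have hxS : (l.last : X) ∈ singSet X := (l.last).2
  -- `l.length ≤ height x`
  have h1 : (l.length : ℕ∞) ≤ height (l.last : X) :=
    (Order.length_le_height_last (p := l)).trans (height_le_height_apply_of_strictMono _ hval _)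
  -- `coheight x + height x = d + 1` and `coheight x ≥ 2`
  have h2 : (coheight (l.last : X) + height (l.last : X) : ℕ∞) = (d + 1 : ℕ) := by
    have := Literature.AlgebraicGeometry.Dimension.coheight_add_height_eq_topologicalKrullDim fX (l.last : X)
    rw [hdim] at this
    exact_mod_cast this
  have h3 : (2 : ℕ∞) ≤ coheight (l.last : X) := by
    have := two_le_ringKrullDim_stalk_of_not_mem_regularLocus hN (x := (l.last : X)) (fun h => hxS h)
    rw [ringKrullDim_stalk_eq_coheight] at this
    exact WithBot.coe_le_coe.mp this
  -- hence `l.length + 2 ≤ d + 1`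
  have h4 : (l.length : ℕ∞) + 2 ≤ (d + 1 : ℕ) := by
    rw [← h2, add_comm (coheight _)]
    exact add_le_add h1 h3
  have h5 : l.length + 2 ≤ d + 1 := by exact_mod_cast h4
  exact_mod_cast (show l.length < d by omega)

/-! ## Points of a zero-dimensional closed subset are closed -/

/-- **The points of a closed subset of dimension `≤ 0` are closed points**: a proper
specialisation inside it would be a chain of length `1`. [folklore] -/
theorem isClosed_singleton_of_topologicalKrullDim_lt_one [QuasiSober X] {S : Set X} (hS : IsClosed S)
    (hdim : topologicalKrullDim ↥S < (1 : ℕ)) {x : X} (hx : x ∈ S) : IsClosed ({x} : Set X) := by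
  haveI := quasiSober_of_isClosed hS
  letI : Preorder ↥S := (specializationOrder _).toPreorder
  rw [topologicalKrullDim_eq_krullDim, Order.krullDim_lt_coe_iff] at hdim
  rw [← closure_subset_iff_isClosed]
  intro y hy
  have hxy : x ⤳ y := specializes_iff_mem_closure.mpr hy
  have hyS : y ∈ S := hS.closure_subset_iff.mpr (Set.singleton_subset_iff.mpr hx) hy
  rw [Set.mem_singleton_iff]
  by_contra hne
  -- `y < x` in `S` (for the specialisation order)
  have hlt : @LT.lt ↥S (specializationOrder ↥S).toLT ⟨y, hyS⟩ ⟨x, hx⟩ := by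
    refine (@lt_iff_le_not_ge ↥S (specializationOrder ↥S).toPreorder _ _).mpr ⟨?_, fun hge => hne ?_⟩
    · change (⟨x, hx⟩ : ↥S) ⤳ ⟨y, hyS⟩
      rw [subtype_specializes_iff]
      exact hxy
    · have hyx : y ⤳ x := (subtype_specializes_iff (⟨y, hyS⟩ : ↥S) ⟨x, hx⟩).1 hge
      exact (hxy.antisymm hyx).symm.eq
  have := hdim ((RelSeries.singleton _ (⟨y, hyS⟩ : ↥S)).snoc ⟨x, hx⟩ hlt)
  simp at this

end LinSec

end Literature.AlgebraicGeometry.Resolution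

end
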